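import Literature.AlgebraicTopology.FundamentalGroup.PuncturedTorusSquareWord
import Literature.AlgebraicTopology.FundamentalGroup.DeformationRetractInclusion
import Mathlib.Analysis.Convex.Topology
import HarnessLib

/-!
# The loop around the puncture of a once-punctured torus is a product of commutators

Topic `Literature/AlgebraicTopology/FundamentalGroup`; sequel of `PuncturedTorusSquareWord.lean`.
Hatcher, *Algebraic Topology* (2002), §1.2 p. 51 (the torus as the square with edges identified,
boundary word `aba⁻¹b⁻¹`), with Prop. 1.5 (change of base point), Prop. 1.17 (deformation
retractions induce isomorphisms) and Thm. 1.7 (`π₁(S¹) ≅ ℤ`): **every loop of the once-punctured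
torus `T ∖ {x₀}` which stays inside the punctured square around the puncture has its class in the
commutator subgroup of `π₁(T ∖ {x₀})`** — the statement consumed by the cell sub-node [AbsTopIII]
Cor 2.7 (b).7 ("an abelian finite étale covering [of the once-punctured elliptic curve] which
necessarily extends to a covering of the one-point compactification": abelian coverings have
trivial monodromy around the puncture, `Literature/Topology/CoveringSpaces/AbelianDeckMonodromy.lean`).

* `mapOfEq_conj` — change of base point commutes with induced maps (Prop. 1.5);
* **`fromPath_projC_mem_commutator`** — for every loop `ω` of `ι → ℝ` (`ι = {i₀, i₁}`) inside the
  punctured closed unit ball, the class of `projC c ∘ ω` lies in the commutator subgroup of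
  `π₁(A, ·)` for every `A ⊇ T ∖ {projC c 0}`: conjugate `ω` radially to a loop at a point of the
  unit sphere; by the radial deformation retraction its class comes from `π₁` of the sphere, which
  after moving the base point to a corner is generated by the square's boundary loop
  (`SquareLoop.zpowers_loop_eq_top`), whose image is a commutator
  (`fromPath_squareLoop_mem_commutator`);
* `fromPath_projC_mem_commutator_of_card_eq_two` — the same with the hypothesis `|ι| = 2`.

Everything is proved; no definitions.

## References

* A. Hatcher, *Algebraic Topology*, CUP (2002), §1.1 Prop. 1.5, §1.2 p. 51, Prop. 1.17, Thm. 1.7.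
  [HatcherAT2002]
-/

noncomputable section

open Set Function Metric Topology unitInterval

namespace Literature.AlgebraicTopology.FundamentalGroup

namespace PuncturedTorus

open SquareLoop

variable {ι : Type*} [Fintype ι] [DecidableEq ι]

/-! ### Naturality of the change of base point -/

/-- **Change of base point commutes with induced maps** (Hatcher, Prop. 1.5 and the remark after
it): for `f : X → Y`, a path `σ` from `z` to `x` and a loop class `g` at `x`,
`f_*(σ · g · σ̄) = (f∘σ) · f_*(g) · (f∘σ)⁻¹`. [cite: HatcherAT2002, §1.1 Prop. 1.5] -/
theorem mapOfEq_conj {X Y : Type*} [TopologicalSpace X] [TopologicalSpace Y] (f : C(X, Y))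
    {x z : X} (σpath : Path z x) (g : _root_.FundamentalGroup X x) :
    _root_.FundamentalGroup.mapOfEq f rfl
        ((_root_.FundamentalGroup.fundamentalGroupMulEquivOfPath σpath).symm g) =
      (_root_.FundamentalGroup.fundamentalGroupMulEquivOfPath (σpath.map f.continuous)).symm
        (_root_.FundamentalGroup.mapOfEq f rfl g) := by
  induction g using Quotient.ind with | _ γ =>
  rw [_root_.FundamentalGroup.mapOfEq_apply, _root_.FundamentalGroup.mapOfEq_apply]
  change Path.Homotopic.Quotient.mk
      (((σpath.trans (γ.trans σpath.symm)).map f.continuous).cast rfl rfl) =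
    Path.Homotopic.Quotient.mk ((σpath.map f.continuous).trans
      (((γ.map f.continuous).cast rfl rfl).trans (σpath.map f.continuous).symm))
  simp only [Path.cast_rfl_rfl, Path.map_trans, Path.map_symm]

/-! ### The main statement -/

section Main

variable {i₀ i₁ : ι} (hne : i₀ ≠ i₁) (hall : ∀ i, i = i₀ ∨ i = i₁) (c : ι → ℝ)
  (A : Set (ι → AddCircle (1 : ℝ))) (hA : {projC c 0}ᶜ ⊆ A)
include hne hall

/-- **The loop around the puncture is a product of commutators.**  Let `T = (ℝ/ℤ)^ι` (`|ι| = 2`),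
`x₀ = projC c 0 ∈ T` and `A ⊇ T ∖ {x₀}`.  For every loop `ω` of `ℝ^ι` inside the punctured closed
unit ball (sup norm), the class of the loop `projC c ∘ ω` of `A` lies in the commutator subgroup of
`π₁(A, projC c (ω 0))`.  Proof: conjugate `ω` by the radial segment to a loop `L` at a point `s₀` of
the unit sphere `S`; by the radial deformation retraction (Hatcher Prop. 1.17) `[L]` comes from
`π₁(S, s₀)`, which after moving the base point to a corner (Prop. 1.5) is generated by the boundary
loop of the square (Thm. 1.7), whose image in `T` is the commutator `[b⁻¹, a⁻¹]` of the edge loops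
(§1.2 p. 51); induced maps and changes of base point preserve the commutator subgroup.
[cite: HatcherAT2002, §1.2 p.51 (torus: boundary word `aba⁻¹b⁻¹`); Prop. 1.5; Prop. 1.17; Thm. 1.7] -/
theorem fromPath_projC_mem_commutator {b : ι → ℝ} (ω : Path b b)
    (hω : ∀ t, ω t ∈ closedBall (0 : ι → ℝ) 1 \ {0}) :
    _root_.FundamentalGroup.fromPath (Path.Homotopic.Quotient.mk
      (VanKampen.liftPath A (ω.map (projC c).continuous) (fun t ↦ projC_mem c A hA (hω t)))) ∈
      commutator (_root_.FundamentalGroup ↥A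
        ⟨projC c b, projC_mem c A hA (ω.source ▸ hω 0)⟩) := by
  classical
  -- the punctured ball, the sphere, the base point `b`
  have hbD : b ∈ closedBall (0 : ι → ℝ) 1 \ {0} := ω.source ▸ hω 0
  have hb0 : b ≠ 0 := fun h ↦ hbD.2 h
  have hbn : 0 < ‖b‖ := norm_pos_iff.2 hb0
  have hb1 : ‖b‖ ≤ 1 := mem_closedBall_zero_iff.1 hbD.1
  -- the radial point `s₀` on the sphere and the radial segment `η : s₀ ⟶ b`
  set s₀ : ι → ℝ := ‖b‖⁻¹ • b with hs₀def
  have hs₀ : s₀ ∈ sphere (0 : ι → ℝ) 1 := by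
    rw [mem_sphere_zero_iff_norm, hs₀def, norm_smul, norm_inv, norm_norm, inv_mul_cancel₀ hbn.ne']
  have hs₀D : s₀ ∈ closedBall (0 : ι → ℝ) 1 \ {0} := sphere_subset_diff hs₀
  set η : Path s₀ b := Path.segment s₀ b with hηdef
  have hη : ∀ t : I, η t ∈ closedBall (0 : ι → ℝ) 1 \ {0} := by
    intro t
    have ht0 := t.2.1
    have ht1 := t.2.2
    have hcoef : η t = ((1 - (t : ℝ)) * ‖b‖⁻¹ + t) • b := by
      rw [hηdef, Path.segment_apply, AffineMap.lineMap_apply_module, hs₀def, smul_smul, ← add_smul]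
    have hinv : 1 ≤ ‖b‖⁻¹ := (one_le_inv₀ hbn).2 hb1
    have hμ : 1 ≤ (1 - (t : ℝ)) * ‖b‖⁻¹ + t := by nlinarith
    rw [hcoef]
    refine ⟨mem_closedBall_zero_iff.2 ?_, smul_ne_zero (by positivity) hb0⟩
    rw [norm_smul, Real.norm_eq_abs, abs_of_pos (by positivity), add_mul,
      mul_assoc, inv_mul_cancel₀ hbn.ne', mul_one]
    nlinarith
  have hηs : ∀ t : I, η.symm t ∈ closedBall (0 : ι → ℝ) 1 \ {0} := fun t ↦ hη (σ t)
  -- the conjugated loop `L = η · ω · η̄` at `s₀`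
  set L : Path s₀ s₀ := η.trans (ω.trans η.symm) with hLdef
  have hL : ∀ t, L t ∈ closedBall (0 : ι → ℝ) 1 \ {0} :=
    VanKampen.trans_mem hη (VanKampen.trans_mem hω hηs)
  -- STEP A (Prop. 1.17): `[L] ∈ π₁(D ∖ 0, s₀)` comes from the sphere
  obtain ⟨g, hg⟩ := (VanKampen.bijective_inclHomOfSubset_of_isStrongDeformationRetractOf
    (sphere_isStrongDeformationRetractOf (E := ι → ℝ)) sphere_subset_diff hs₀).2
    (_root_.FundamentalGroup.fromPath (Path.Homotopic.Quotient.mk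
      (VanKampen.liftPath (closedBall (0 : ι → ℝ) 1 \ {0}) L hL)))
  -- STEP B (Prop. 1.5 + Thm. 1.7): inside the sphere, move to the corner; there `π₁` is cyclic
  have hSpc : IsPathConnected (sphere (0 : ι → ℝ) 1) := by
    have hS : sphere (0 : ι → ℝ) 1 = range (loop i₀) :=
      Subset.antisymm (fun x hx ↦ mem_range_loop hne hall (mem_sphere_zero_iff_norm.1 hx))
        (range_subset_iff.2 (loop_mem_sphere hne))
    rw [hS]
    haveI : PathConnectedSpace I := isPathConnected_iff_pathConnectedSpace.mp
      ((convex_Icc (0 : ℝ) 1).isPathConnected ⟨0, le_rfl, zero_le_one⟩)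
    exact isPathConnected_range (loop i₀).continuous
  obtain ⟨σp, hσp⟩ : ∃ σp : Path s₀ (pt i₀ (-1) (-1)), ∀ t, σp t ∈ sphere (0 : ι → ℝ) 1 :=
    ⟨(hSpc.joinedIn s₀ hs₀ _ (corner_mem_sphere i₀)).somePath,
      (hSpc.joinedIn s₀ hs₀ _ (corner_mem_sphere i₀)).somePath_mem⟩
  set σS : Path (⟨s₀, hs₀⟩ : ↥(sphere (0 : ι → ℝ) 1)) ⟨pt i₀ (-1) (-1), corner_mem_sphere i₀⟩ :=
    (VanKampen.liftPath (sphere (0 : ι → ℝ) 1) σp hσp).cast rfl rfl with hσSdef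
  set xS : _root_.FundamentalGroup ↥(sphere (0 : ι → ℝ) 1) ⟨pt i₀ (-1) (-1), corner_mem_sphere i₀⟩ :=
    _root_.FundamentalGroup.fromPath (Path.Homotopic.Quotient.mk
      (VanKampen.liftPath (sphere (0 : ι → ℝ) 1) (loop i₀) (loop_mem_sphere hne))) with hxSdef
  obtain ⟨n, hn⟩ : ∃ n : ℤ, xS ^ n = _root_.FundamentalGroup.fundamentalGroupMulEquivOfPath σS g := by
    rw [← Subgroup.mem_zpowers_iff, hxSdef, zpowers_loop_eq_top hne hall]
    exact Subgroup.mem_top _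
  have hg' : g = (_root_.FundamentalGroup.fundamentalGroupMulEquivOfPath σS).symm (xS ^ n) := by
    rw [hn, MulEquiv.symm_apply_apply]
  -- STEP C: push everything forward to `A` along `projC c`
  let PT : C(↥(closedBall (0 : ι → ℝ) 1 \ {0}), ↥A) :=
    ⟨fun x ↦ ⟨projC c x, projC_mem c A hA x.2⟩,
      ((projC c).continuous.comp continuous_subtype_val).subtype_mk _⟩
  let PI : C(↥(sphere (0 : ι → ℝ) 1), ↥A) :=
    PT.comp (ContinuousMap.inclusion sphere_subset_diff)
  set F := _root_.FundamentalGroup.mapOfEq PT (rfl : PT ⟨s₀, hs₀D⟩ = PT ⟨s₀, hs₀D⟩) with hFdef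
  -- (C1) `F ∘ incl = (PI)_*` at `s₀`
  have hC1 : F.comp (VanKampen.inclHomOfSubset sphere_subset_diff s₀ hs₀ hs₀D) =
      _root_.FundamentalGroup.mapOfEq PI (rfl : PI ⟨s₀, hs₀⟩ = PI ⟨s₀, hs₀⟩) := by
    ext q
    induction q using Quotient.ind with | _ γ =>
    change F (VanKampen.inclHomOfSubset sphere_subset_diff s₀ hs₀ hs₀D
        (_root_.FundamentalGroup.fromPath (Path.Homotopic.Quotient.mk γ))) =
      _root_.FundamentalGroup.mapOfEq PI rfl
        (_root_.FundamentalGroup.fromPath (Path.Homotopic.Quotient.mk γ))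
    rw [VanKampen.inclHomOfSubset, _root_.FundamentalGroup.mapOfEq_apply,
      _root_.FundamentalGroup.mapOfEq_apply, _root_.FundamentalGroup.mapOfEq_apply]
    rfl
  -- (C2) the boundary loop goes to a commutator
  have hC2 : _root_.FundamentalGroup.mapOfEq PI
      (rfl : PI ⟨pt i₀ (-1) (-1), corner_mem_sphere i₀⟩ = PI ⟨pt i₀ (-1) (-1), corner_mem_sphere i₀⟩)
      xS ∈ commutator (_root_.FundamentalGroup ↥A (PI ⟨pt i₀ (-1) (-1), corner_mem_sphere i₀⟩)) := by
    have h := fromPath_squareLoop_mem_commutator hne c A hA (i₀ := i₀)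
    rw [hxSdef, _root_.FundamentalGroup.mapOfEq_apply]
    exact h
  -- (C3) assemble: `F [L] = (PI∘σ)-conjugate of ((PI)_* xS)^n`
  have hC3 : F (_root_.FundamentalGroup.fromPath (Path.Homotopic.Quotient.mk
      (VanKampen.liftPath (closedBall (0 : ι → ℝ) 1 \ {0}) L hL))) ∈
      commutator (_root_.FundamentalGroup ↥A (PT ⟨s₀, hs₀D⟩)) := by
    have hconj := mapOfEq_conj PI σS (xS ^ n)
    have hC3' : _root_.FundamentalGroup.mapOfEq PI rfl
        ((_root_.FundamentalGroup.fundamentalGroupMulEquivOfPath σS).symm (xS ^ n)) ∈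
        commutator (_root_.FundamentalGroup ↥A (PI ⟨s₀, hs₀⟩)) := by
      rw [hconj, map_zpow, map_zpow]
      exact Subgroup.zpow_mem _ (map_mem_commutator _ hC2) n
    rw [← hg, hg', ← MonoidHom.comp_apply, hC1]
    exact hC3'
  -- STEP D: back from `L = η · ω · η̄` to `ω` (Prop. 1.5 again)
  have hωA : ∀ t, (ω.map (projC c).continuous) t ∈ A := fun t ↦ projC_mem c A hA (hω t)
  have hηA : ∀ t, (η.map (projC c).continuous) t ∈ A := fun t ↦ projC_mem c A hA (hη t)
  set ωA := VanKampen.liftPath A (ω.map (projC c).continuous) hωA with hωAdef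
  set ηA := VanKampen.liftPath A (η.map (projC c).continuous) hηA with hηAdef
  have hFL : F (_root_.FundamentalGroup.fromPath (Path.Homotopic.Quotient.mk
      (VanKampen.liftPath (closedBall (0 : ι → ℝ) 1 \ {0}) L hL))) =
      (_root_.FundamentalGroup.fundamentalGroupMulEquivOfPath ηA).symm
        (_root_.FundamentalGroup.fromPath (Path.Homotopic.Quotient.mk ωA)) := by
    rw [hFdef, _root_.FundamentalGroup.mapOfEq_apply]
    change Path.Homotopic.Quotient.mk ((((VanKampen.liftPath (closedBall (0 : ι → ℝ) 1 \ {0})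
        L hL)).map PT.continuous).cast rfl rfl) =
      Path.Homotopic.Quotient.mk (ηA.trans (ωA.trans ηA.symm))
    refine congrArg Path.Homotopic.Quotient.mk (Path.ext (funext fun t ↦ Subtype.ext ?_))
    change projC c (L t) = (((ηA.trans (ωA.trans ηA.symm)) t : ↥A) : ι → AddCircle (1 : ℝ))
    simp only [hLdef, Path.trans_apply, hηAdef, hωAdef]
    split_ifs <;> rfl
  have hfin := map_mem_commutator (_root_.FundamentalGroup.fundamentalGroupMulEquivOfPath ηA)
    (hFL ▸ hC3)
  rwa [MulEquiv.apply_symm_apply] at hfin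

omit hne hall in
/-- The same statement with the hypothesis `|ι| = 2` (as for the tree's `ComplexTorus Φ`,
`Φ : ℝ^ι ≃ ℂ`). [cite: HatcherAT2002, §1.2 p.51 (torus: boundary word `aba⁻¹b⁻¹`)] -/
theorem fromPath_projC_mem_commutator_of_card_eq_two (hι : Fintype.card ι = 2) {b : ι → ℝ}
    (ω : Path b b) (hω : ∀ t, ω t ∈ closedBall (0 : ι → ℝ) 1 \ {0}) :
    _root_.FundamentalGroup.fromPath (Path.Homotopic.Quotient.mk
      (VanKampen.liftPath A (ω.map (projC c).continuous) (fun t ↦ projC_mem c A hA (hω t)))) ∈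
      commutator (_root_.FundamentalGroup ↥A
        ⟨projC c b, projC_mem c A hA (ω.source ▸ hω 0)⟩) := by
  classical
  have h2 : Nat.card ι = 2 := by rw [Nat.card_eq_fintype_card, hι]
  obtain ⟨i₀, i₁, hne, huniv⟩ := Nat.card_eq_two_iff.1 h2
  have hall : ∀ i, i = i₀ ∨ i = i₁ := fun i ↦ by
    have hi : i ∈ ({i₀, i₁} : Set ι) := by rw [huniv]; exact Set.mem_univ i
    simpa using hi
  exact fromPath_projC_mem_commutator hne hall c A hA ω hω

end Main

end PuncturedTorus

end Literature.AlgebraicTopology.FundamentalGroup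

end
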